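/-
Copyright (c) 2026 the pub-hodgecm-mathlib formalisation cell (harness21).  Prover seat hodgecm-mathlib-LH4-p11 (g5), req620 Track A «(D-RAM) FOUR-FRAME» squad
(unit U2H_HSide, the (ρ2b′-X) road :418; bottom socket (A) «type U»: the SIGN step of the head `orderCountCensusA`).
-/
import Summits.HodgeConjecture.HodgeConjecture.Theorems.F0P3cDyRamFixedPointCensusTypeTwoCensusOfOrderCountsV3   -- ★ (this seat): brings every token of the bottom sockets
import Summits.HodgeConjecture.HodgeConjecture.Theorems.F0P3cDyRamTypeUBottomFacts                 -- ★ p857997 (this seat)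
import Summits.HodgeConjecture.HodgeConjecture.Theorems.F0P3cDyRamUniformizerPowerTube              -- ★ p858117 (this seat)
import Summits.HodgeConjecture.HodgeConjecture.Theorems.F0P3cDyRamTypeTwoTubeLetters                 -- ★ p858060 (this seat)
import Summits.HodgeConjecture.HodgeConjecture.Theorems.F0P3cDyRamUnramifiedQuadraticCompletionDictionary   -- ★ LH4-p10: the e = 1 dictionary
import Literature.NumberTheory.Automorphic.RamifiedPlaceResidueApproximation                       -- ★ p857812 (LH4-p09): `exists_valued_sub_toPlace_lt_one_of_ne_one`
import Literature.NumberTheory.Automorphic.ProjectiveDescentLatticeLevelsDischarge                 -- ★ `valued_toPlace_eq_pow_two_of_ramified`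
import Literature.NumberTheory.Rogawski1990.FinExplicitTransferFactorInertExponent                  -- ★ `eval_finCharpolyTwo_finGammaTwo_apply_eq_quadratic`
import Summits.HodgeConjecture.HodgeConjecture.Theorems.F0P3cDyRamTokenSignUnr                        -- ★ p857454 (LH4-p13): O-Sign, `exists_normOne_sqrt`
import Summits.HodgeConjecture.HodgeConjecture.Theorems.F0P3cDyRamThetaRhoFixedNormUnit               -- ★ p858220 (LH4-p14): hKnorm
import Summits.HodgeConjecture.HodgeConjecture.Theorems.F0P3cDyRamThetaRhoFixedEven                   -- ★ p858152 (LH4-p14): hKev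
import Summits.HodgeConjecture.HodgeConjecture.Theorems.F0P3cDyRamTypeASignModel                      -- ★ p858290 (this seat): the line letters
import Literature.NumberTheory.QuadraticForms.HilbertSymbolUnramifiedClassModel                     -- ★ p857525 (LH4-p13): the hA bridge
import Literature.NumberTheory.Automorphic.UnitaryGroupInertPlaceHyperbolicBasis                    -- ★ `exists_toPlace_eq_of_galAdicCompletionMap_eq`
import Literature.NumberTheory.LocalFields.CompleteValuedSquareRootNearOne                          -- ★ square roots near `1`
import HarnessLib

/-!
# Crux `H413`, line LH4 «(D-RAM) FOUR-FRAME» — the (ρ2b′-X) road, bottom socket (A), type U: THE SIGN `(β, θ)_v = (−1)^(m+d)` IN THE HEAD'S LETTERS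

Cell `hodgecm-mathlib` (D-0151), FLOOR 0, crux item H413 = `stmt-HodgeConjecture-24833`; squad F0∕P3c∕LH4; bottom socket (A) (payer LH4-p14).  This file is STEP 15 of the head
`F0P3cDyRamOrderCountCensusUnr.orderCountCensusA` (split off for the 400-line rule): from the socket-(A) letters (frame, type `|α − ρα| = 1`, `|ρα − Θα| < 1`), the block congruence
`γ_H ≡ 1 (mod ϖ^(2d+5t_E+2))` of the chosen `V`, the conductor level `|lam − ρlam| = exp(−2n)` and the printed `m`-∕`β`-tokens, **`(β, θ)_v = (−1)^(m+d)`** — ★ LH4-p13's O-Sign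
`hilbertSymbol_token_eq_neg_one_pow` with: `δ_w` (★ `exists_normOne_sqrt`, `|det − 1| < |4|`), the tube `hn hn4 hdeep` (★ `F0P3cDyRamUniformizerPowerTube`), the letter `a` with
`ι a = t∕δ_w − 2` (★ descent of `σ_w`-fixed elements), `c = 2r₀`, `r₀² = 1 + a∕4` (★ square roots near 1, `|a|_v < |16|_v` from the tube), and `hA` read by ★ p857525 from the line
`j(F) ⊕ j(F)·𝔩`, `𝔩 = λ′ − ρλ′` (★ `F0P3cDyRamTypeASignModel`), hKev by ★ LH4-p14 `even_v_of_thetaRho_fixed`, hKnorm by ★ LH4-p14 `exists_thetaRho_fixed_unit_norm_eq`.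
ONE THEOREM (no `def`, no instance, no notation, no `sorry`); lane `--supports stmt-HodgeConjecture-24833 --as helper` (count-neutral).
HONEST LABEL.  Count-neutral; nothing printed is asserted; (ρ2b′-X) stays OPEN; `HC_CM` is proved only modulo the 7 printed citations (2 remaining named inputs: hLiu418 =
`stmt-HodgeConjecture-24832`, h413 = `stmt-HodgeConjecture-24833`) until rung 0 closes.

## References
* [Rogawski1990] J. D. Rogawski, *Automorphic Representations of Unitary Groups in Three Variables*, Ann. of Math. Stud. 123 (1990), §4.9 p. 55, Lemma 4.9.3 p. 56.
* [LabesseLanglands1979] J.-P. Labesse, R. P. Langlands, *L-indistinguishability for SL(2)*, Canad. J. Math. 31 (1979), §2 (2.1)–(2.2) pp. 8–10.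
* [Serre1979] J.-P. Serre, *Local Fields*, GTM 67 (1979), Ch. V §2 Prop. 3; Ch. XIV §3–§4.
-/

set_option autoImplicit false

noncomputable section

namespace Summit.HodgeConjecture.HodgeConjecture.Cruxes.H413.F0P3cDyRamOrderCountCensusUnrSign

open NumberField IsDedekindDomain Topology Filter
open Literature.NumberTheory.Automorphic Literature.NumberTheory.Automorphic.UnitaryGroup
open Literature.NumberTheory.Rogawski1990 Literature.NumberTheory.GaloisRepresentations
open Literature.NumberTheory.Automorphic.UnitaryThreeFourFrame
open scoped Matrix MatrixGroups Classical Valued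
open Literature.NumberTheory.QuadraticForms
open Summit.HodgeConjecture.HodgeConjecture.Cruxes.H413.F0P3cDyRamToricCensusDefs

set_option maxHeartbeats 800000 in
-- the socket-(A) binder tower at the CM place (same budget as the head)
/-- **THE SIGN ON TYPE (A): `(β, θ)_v = (−1)^(m+d)`** for a type-(2) `γ_H ≡ 1 (mod ϖ^(2d+5t_E+2))` at a wild ramified CM place, in the socket-(A) letters (type U: `|α − ρα| = 1`,
`|ρα − Θα| < 1`), given the conductor level `|lam − ρlam| = exp(−2n)` and the printed `m`-∕`β`-tokens. [cite: Rogawski1990, §4.9 p. 55, Lemma 4.9.3 p. 56]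
[cite: LabesseLanglands1979, §2 (2.1)–(2.2) pp. 8–10] [cite: Serre1979, Ch. V §2 Prop. 3] -/
theorem sign_typeA (L : Type) [Field L] [NumberField L] [IsCMField L]
    {v : HeightOneSpectrum (𝓞 ↥(maximalRealSubfield L))} (w : UnitaryGroup.PlacesOver L v)
    (hw : IsCMField.complexConj L • w.1 = w.1) (he : v.asIdeal.ramificationIdx' w.1.asIdeal ≠ 1)
    (ϖ : (w.1.adicCompletion L)) (hϖ : Valued.v ϖ = WithZero.exp (-1 : ℤ)) (d tE : ℕ)
    (hD : IsRamifiedQuadraticDatum (galAdicCompletionMap (L := L) (IsCMField.complexConj L) hw) ϖ d tE) (h2v : Valued.v (2 : (w.1.adicCompletion L)) < 1)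
    (γH : ((UnitaryGroup.cmDatum L 2 (Matrix.of fun i j : Fin 2 => if i.val + j.val + 1 = 2 then (1 : L) else 0)).Local v ×
      (UnitaryGroup.cmDatum L 1 (Matrix.of fun i j : Fin 1 => if i.val + j.val + 1 = 1 then (1 : L) else 0)).Local v))
    (hg : ∀ i j : Fin 2, Valued.v ((((γH.1.val : GL (Fin 2) (UnitaryGroup.LocalRing L v)).val.map (Pi.evalRingHom (fun w' : UnitaryGroup.PlacesOver L v => w'.1.adicCompletion L) w))) i j - (1 : Matrix (Fin 2) (Fin 2) (w.1.adicCompletion L)) i j) ≤ Valued.v (ϖ ^ (2 * d + 4 * tE + 2 + tE)))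
    (hu₂ : Valued.v (finGammaTwo L v γH w - 1) ≤ Valued.v (ϖ ^ (2 * d + 4 * tE + 2 + tE)))
    (E' : Type) [Field E'] [NumberField E'] [Algebra L E'] [Algebra.IsQuadraticExtension L E'] (c₁ : E' ≃ₐ[L] E')
    (w₁ : UnitaryGroup.PlacesOver E' w.1) (hw₁ : c₁ • w₁.1 = w₁.1)
    (Θ : (w₁.1.adicCompletion E') →+* (w₁.1.adicCompletion E')) (α lam : (w₁.1.adicCompletion E')) (hc₁ : c₁ ≠ 1)
    (hDD : (((γH.1.val : GL (Fin 2) (UnitaryGroup.LocalRing L v)).val.map (Pi.evalRingHom (fun w' : UnitaryGroup.PlacesOver L v => w'.1.adicCompletion L) w))).det * (galAdicCompletionMap (L := L) (IsCMField.complexConj L) hw) (((γH.1.val : GL (Fin 2) (UnitaryGroup.LocalRing L v)).val.map (Pi.evalRingHom (fun w' : UnitaryGroup.PlacesOver L v => w'.1.adicCompletion L) w))).det = 1)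
    (htr : (((γH.1.val : GL (Fin 2) (UnitaryGroup.LocalRing L v)).val.map (Pi.evalRingHom (fun w' : UnitaryGroup.PlacesOver L v => w'.1.adicCompletion L) w))).trace = (((γH.1.val : GL (Fin 2) (UnitaryGroup.LocalRing L v)).val.map (Pi.evalRingHom (fun w' : UnitaryGroup.PlacesOver L v => w'.1.adicCompletion L) w))).det * (galAdicCompletionMap (L := L) (IsCMField.complexConj L) hw) (((γH.1.val : GL (Fin 2) (UnitaryGroup.LocalRing L v)).val.map (Pi.evalRingHom (fun w' : UnitaryGroup.PlacesOver L v => w'.1.adicCompletion L) w))).trace)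
    (hρρ : ∀ z, galAdicCompletionMap (L := E') c₁ hw₁ (galAdicCompletionMap (L := E') c₁ hw₁ z) = z) (hvρ : ∀ z, Valued.v (galAdicCompletionMap (L := E') c₁ hw₁ z) = Valued.v z)
    (hρj : ∀ a, galAdicCompletionMap (L := E') c₁ hw₁ (toPlace w.1 w₁ a) = toPlace w.1 w₁ a) (hjv : ∀ a, Valued.v (toPlace w.1 w₁ a) ≤ 1 ↔ Valued.v a ≤ 1)
    (hjfix : ∀ z : (w₁.1.adicCompletion E'), galAdicCompletionMap (L := E') c₁ hw₁ z = z ↔ ∃ a, toPlace w.1 w₁ a = z)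
    (hΘj : ∀ a, Θ (toPlace w.1 w₁ a) = toPlace w.1 w₁ ((galAdicCompletionMap (L := L) (IsCMField.complexConj L) hw) a)) (hΘΘ : ∀ z, Θ (Θ z) = z)
    (hΘρ : ∀ z, Θ (galAdicCompletionMap (L := E') c₁ hw₁ z) = galAdicCompletionMap (L := E') c₁ hw₁ (Θ z)) (hvΘ : ∀ z, Valued.v (Θ z) = Valued.v z)
    (hα1 : Valued.v α ≤ 1) (hint : ∀ z : (w₁.1.adicCompletion E'), Valued.v z ≤ 1 → Valued.v ((z - galAdicCompletionMap (L := E') c₁ hw₁ z) / (α - galAdicCompletionMap (L := E') c₁ hw₁ α)) ≤ 1)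
    (hlam2 : lam * lam = toPlace w.1 w₁ (((γH.1.val : GL (Fin 2) (UnitaryGroup.LocalRing L v)).val.map (Pi.evalRingHom (fun w' : UnitaryGroup.PlacesOver L v => w'.1.adicCompletion L) w))).trace * lam - toPlace w.1 w₁ (((γH.1.val : GL (Fin 2) (UnitaryGroup.LocalRing L v)).val.map (Pi.evalRingHom (fun w' : UnitaryGroup.PlacesOver L v => w'.1.adicCompletion L) w))).det)
    (hρlam : galAdicCompletionMap (L := E') c₁ hw₁ lam = toPlace w.1 w₁ (((γH.1.val : GL (Fin 2) (UnitaryGroup.LocalRing L v)).val.map (Pi.evalRingHom (fun w' : UnitaryGroup.PlacesOver L v => w'.1.adicCompletion L) w))).trace - lam) (hΘlam : Θ lam * lam = 1)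
    (hA : Valued.v (α - galAdicCompletionMap (L := E') c₁ hw₁ α) = 1) (hτα : Valued.v (galAdicCompletionMap (L := E') c₁ hw₁ α - Θ α) < 1)
    (hu : Valued.v ((((localNonsplitEquiv (IsCMField.complexConj L) (Matrix.of fun i j : Fin 1 => if i.val + j.val + 1 = 1 then (1 : L) else 0) (IsCMField.complexConj_ne_one L) w hw γH.2).val : GL (Fin 1) (w.1.adicCompletion L)) : Matrix (Fin 1) (Fin 1) (w.1.adicCompletion L)) 0 0) = 1)
    {n : ℕ} (hjlv : Valued.v (lam - galAdicCompletionMap (L := E') c₁ hw₁ lam) = WithZero.exp (-((2 * n : ℕ) : ℤ)))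
    {m : ℕ} {β : (v.adicCompletion ↥(maximalRealSubfield L))ˣ}
    (hm : Valued.v (((finCharpolyTwo L v γH).eval (finGammaTwo L v γH)) w) = Valued.v ((toPlace v w (HeckeCharacter.uniformizer ↥(maximalRealSubfield L) v : v.adicCompletion ↥(maximalRealSubfield L))) ^ m))
    (hβ : toPlace v w (β : (v.adicCompletion ↥(maximalRealSubfield L))) = -(((finCharpolyTwo L v γH).eval (finGammaTwo L v γH)) w * (finGammaTwo L v γH w ^ 2 + ((γH.1.val.val : Matrix (Fin 2) (Fin 2) (UnitaryGroup.LocalRing L v)).map (Pi.evalRingHom (fun w' : UnitaryGroup.PlacesOver L v => w'.1.adicCompletion L) w)).det)) / (2 * finGammaTwo L v γH w ^ 2 * ((γH.1.val.val : Matrix (Fin 2) (Fin 2) (UnitaryGroup.LocalRing L v)).map (Pi.evalRingHom (fun w' : UnitaryGroup.PlacesOver L v => w'.1.adicCompletion L) w)).det)) :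
    hilbertSymbol (v.adicCompletion ↥(maximalRealSubfield L)) (β : (v.adicCompletion ↥(maximalRealSubfield L)))
        (algebraMap ↥(maximalRealSubfield L) _ ((cmQuadraticGenerator L : 𝓞 ↥(maximalRealSubfield L)) : ↥(maximalRealSubfield L))) = (-1) ^ (m + d) := by
  classical
  haveI : Finite 𝓀[w₁.1.adicCompletion E'] := finite_residueField_adicCompletion E' w₁.1
  have hjv1 : ∀ a, Valued.v (toPlace w.1 w₁ a) = Valued.v a := fun a =>
    F0P3cDyRamUnramifiedQuadraticCompletionDictionary.valued_toPlace_of_v_sub_galAdicCompletionMap_eq_one E' c₁ w.1 hc₁ w₁ hw₁ hα1 hA a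
  have hϖE : Valued.v (toPlace w.1 w₁ ϖ) = WithZero.exp (-1 : ℤ) := by rw [hjv1, hϖ]
  obtain ⟨hσσ, hσv, -, hfixw, hdd, hd1, h2t⟩ := id hD
  have hN : 2 * d + tE ≤ 2 * (2 * d + 4 * tE + 2) + 1 ∧ 2 * tE < 2 * d + 4 * tE + 2 ∧ tE < 2 * d + 4 * tE + 2 + tE ∧ 2 * tE < 2 * d + 4 * tE + 2 + tE ∧
      2 * tE + 2 ≤ 2 * d + 4 * tE + 2 + tE ∧ tE ≤ 2 * d + 4 * tE + 2 + tE ∧ 2 * d + 4 * tE + 2 + tE - tE = 2 * d + 4 * tE + 2 ∧ 2 * d ≤ 2 * d + 4 * tE + 2 + tE := by omega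
  have h20 : (2 : w.1.adicCompletion L) ≠ 0 := fun h0 => by
    have := h2t; rw [h0, map_zero] at this
    exact (pow_ne_zero tE (by rw [hϖ]; exact WithZero.exp_ne_zero)) this.symm
  have hσι : ∀ y, (galAdicCompletionMap (L := L) (IsCMField.complexConj L) hw) (toPlace v w y) = toPlace v w y :=
    fun y => galAdicCompletionMap_toPlace (IsCMField.complexConj L) w w hw y
  have hι2 : ∀ y, Valued.v (toPlace v w y) = Valued.v y ^ 2 :=
    fun y => valued_toPlace_eq_pow_two_of_ramified (IsCMField.complexConj L) w (IsCMField.complexConj_ne_one L) hw he y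
  have hresE : ∀ x : w.1.adicCompletion L, Valued.v x ≤ 1 →
      ∃ y : v.adicCompletion ↥(maximalRealSubfield L), Valued.v (toPlace v w y) ≤ 1 ∧ Valued.v (x - toPlace v w y) < 1 := fun x hx => by
    obtain ⟨y, hy1, hy⟩ := exists_valued_sub_toPlace_lt_one_of_ne_one L (IsCMField.complexConj L) v w (IsCMField.complexConj_ne_one L) hw he x hx
    exact ⟨y, by rw [hι2]; exact pow_le_one₀ zero_le hy1, hy⟩
  have hσϖ : (galAdicCompletionMap (L := L) (IsCMField.complexConj L) hw) ϖ ≠ ϖ := fun h0 => by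
    have h1 := hdd
    rw [h0, sub_self, map_zero] at h1
    exact pow_ne_zero d (by rw [hϖ]; exact WithZero.exp_ne_zero) h1.symm
  have h2M : Valued.v (2 : w₁.1.adicCompletion E') < 1 := by rw [← map_ofNat (toPlace w.1 w₁) 2, hjv1]; exact h2v
  have h2Mne : (2 : w₁.1.adicCompletion E') ≠ 0 := by rw [← map_ofNat (toPlace w.1 w₁) 2]; exact (map_ne_zero _).2 h20
  have hH1 : IsUnit ((placeForm (Matrix.of fun i j : Fin 1 => if i.val + j.val + 1 = 1 then (1 : L) else 0) w.1) 0 0) := by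
    rw [placeForm_antidiagOne]; simp [StdForm.over, StdForm.antidiagonal_J_apply, Fin.rev]
  have hσu := F0P3cDyRamTypeUBottomFacts.mul_map_eq_one_of_mem_unitary_one (galAdicCompletionMap (L := L) (IsCMField.complexConj L) hw) hH1
    (localNonsplitEquiv (IsCMField.complexConj L) (Matrix.of fun i j : Fin 1 => if i.val + j.val + 1 = 1 then (1 : L) else 0)
      (IsCMField.complexConj_ne_one L) w hw γH.2).2
  have hϖF := HeckeCharacter.valued_uniformizer (K := ↥(maximalRealSubfield L)) v
  have hN4 : Valued.v (ϖ ^ (2 * d + 4 * tE + 2 + tE)) < Valued.v (4 : w.1.adicCompletion L) := F0P3cDyRamUniformizerPowerTube.v_pow_lt_v_four hϖ h2t hN.2.2.2.1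
  have hc1 : Valued.v (ϖ ^ (2 * d + 4 * tE + 2 + tE)) ≤ 1 := F0P3cDyRamUniformizerPowerTube.v_pow_le_one hϖ _
  have hdet1 := F0P3cDyRamTypeTwoTubeLetters.v_det_sub_one_le hc1 hg
  have hDD' : (galAdicCompletionMap (L := L) (IsCMField.complexConj L) hw) (((γH.1.val : GL (Fin 2) (UnitaryGroup.LocalRing L v)).val.map (Pi.evalRingHom (fun w' : UnitaryGroup.PlacesOver L v => w'.1.adicCompletion L) w))).det * (((γH.1.val : GL (Fin 2) (UnitaryGroup.LocalRing L v)).val.map (Pi.evalRingHom (fun w' : UnitaryGroup.PlacesOver L v => w'.1.adicCompletion L) w))).det = 1 := by rw [mul_comm]; exact hDD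
  obtain ⟨δw, hδδ, hσδ, hδ1⟩ := F0P3cDyRamTokenSignUnr.exists_normOne_sqrt L w hw hσv hDD' (hdet1.trans_lt hN4)
  have hD0 : (((γH.1.val : GL (Fin 2) (UnitaryGroup.LocalRing L v)).val.map (Pi.evalRingHom (fun w' : UnitaryGroup.PlacesOver L v => w'.1.adicCompletion L) w))).det ≠ 0 := fun h0 => by rw [h0, zero_mul] at hDD; exact zero_ne_one hDD
  have hδ0 : δw ≠ 0 := fun h0 => hD0 (by rw [← hδδ, h0, mul_zero])
  have hδn : Valued.v (δw - 1) ≤ Valued.v ϖ ^ (2 * d + 4 * tE + 2 + tE - tE) := F0P3cDyRamUniformizerPowerTube.v_sqrt_sub_one_le hϖ h2t hδδ hδ1 hdet1 hN.2.2.2.2.2.1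
  rw [hN.2.2.2.2.2.2.1] at hδn
  have hn1 : Valued.v ϖ ^ (2 * d + 4 * tE + 2) < 1 := by
    have h := F0P3cDyRamUniformizerPowerTube.v_pow_lt_v_pow hϖ (show 0 < 2 * d + 4 * tE + 2 by omega)
    rwa [pow_zero] at h
  have hδlt1 : Valued.v (δw - 1) < 1 := lt_of_le_of_lt hδn hn1
  have hun : Valued.v (finGammaTwo L v γH w - 1) ≤ Valued.v ϖ ^ (2 * d + 4 * tE + 2) :=
    hu₂.trans (by rw [map_pow]; exact F0P3cDyRamUniformizerPowerTube.v_pow_le_v_pow hϖ (show 2 * d + 4 * tE + 2 ≤ 2 * d + 4 * tE + 2 + tE by omega))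
  have hdeep : Valued.v (finGammaTwo L v γH w / δw - 1) ≤ Valued.v ϖ ^ (2 * d + 4 * tE + 2) := F0P3cDyRamUniformizerPowerTube.v_div_sub_one_le hδlt1 hun hδn
  have hu0 : finGammaTwo L v γH w ≠ 0 := fun h0 => by have h1 := hu; rw [show (((((localNonsplitEquiv (IsCMField.complexConj L) (Matrix.of fun i j : Fin 1 => if i.val + j.val + 1 = 1 then (1 : L) else 0) (IsCMField.complexConj_ne_one L) w hw γH.2)).val : GL (Fin 1) (w.1.adicCompletion L)) : Matrix (Fin 1) (Fin 1) (w.1.adicCompletion L)) 0 0) = finGammaTwo L v γH w from rfl, h0, map_zero] at h1; exact zero_ne_one h1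
  -- the letter `a + 2 = t/δw` in `F_v`
  have hfixa : (galAdicCompletionMap (L := L) (IsCMField.complexConj L) hw) ((((γH.1.val : GL (Fin 2) (UnitaryGroup.LocalRing L v)).val.map (Pi.evalRingHom (fun w' : UnitaryGroup.PlacesOver L v => w'.1.adicCompletion L) w))).trace / δw - 2) = (((γH.1.val : GL (Fin 2) (UnitaryGroup.LocalRing L v)).val.map (Pi.evalRingHom (fun w' : UnitaryGroup.PlacesOver L v => w'.1.adicCompletion L) w))).trace / δw - 2 := by
    rw [map_sub, F0P3cDyRamTypeASignModel.map_trace_div_delta_eq (galAdicCompletionMap (L := L) (IsCMField.complexConj L) hw) htr hδδ hσδ hD0, map_ofNat]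
  obtain ⟨a, ha⟩ := exists_toPlace_eq_of_galAdicCompletionMap_eq (IsCMField.complexConj L) w (IsCMField.complexConj_ne_one L) hw _ hfixa
  have ha' : toPlace v w a = (finGammaTwo L v γH w ^ 2 + (((γH.1.val : GL (Fin 2) (UnitaryGroup.LocalRing L v)).val.map (Pi.evalRingHom (fun w' : UnitaryGroup.PlacesOver L v => w'.1.adicCompletion L) w))).det - ((finCharpolyTwo L v γH).eval (finGammaTwo L v γH)) w) / (finGammaTwo L v γH w * δw) - 2 := by
    rw [eval_finCharpolyTwo_finGammaTwo_apply_eq_quadratic, F0P3cDyRamTypeASignModel.oSign_a_letter hu0 hδ0]; exact ha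
  -- the line generator `𝔩 = λ′ − ρλ′` and its square
  have hΘ𝔩 := F0P3cDyRamTypeASignModel.theta_line_eq_neg (galAdicCompletionMap (L := L) (IsCMField.complexConj L) hw) (toPlace w.1 w₁) (galAdicCompletionMap (L := E') c₁ hw₁) Θ hΘρ hΘj hρj hlam2 hρlam hΘlam hδδ hσδ hD0
  have hρ𝔩 := F0P3cDyRamTypeASignModel.map_line_eq_neg (galAdicCompletionMap (L := E') c₁ hw₁) hρρ (lam / toPlace w.1 w₁ δw)
  have hΘρ𝔩 := F0P3cDyRamTypeASignModel.theta_rho_line_eq (galAdicCompletionMap (L := L) (IsCMField.complexConj L) hw) (toPlace w.1 w₁) (galAdicCompletionMap (L := E') c₁ hw₁) Θ hρρ hΘρ hΘj hρj hlam2 hρlam hΘlam hδδ hσδ hD0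
  have h𝔩sq := F0P3cDyRamTypeASignModel.line_sq_eq (toPlace w.1 w₁) (galAdicCompletionMap (L := E') c₁ hw₁) hρj hlam2 hρlam hδδ hD0
  -- `a ≠ 0`: otherwise `𝔩 = 0`, i.e. `lam = ρ lam`, against `|lam − ρlam| = exp(−2n)`
  have h𝔩0 : lam / toPlace w.1 w₁ δw - (galAdicCompletionMap (L := E') c₁ hw₁) (lam / toPlace w.1 w₁ δw) ≠ 0 := by
    intro h0
    have hjδ : toPlace w.1 w₁ δw ≠ 0 := (map_ne_zero _).2 hδ0
    have : lam - (galAdicCompletionMap (L := E') c₁ hw₁) lam = 0 := by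
      have h1 : (lam / toPlace w.1 w₁ δw - (galAdicCompletionMap (L := E') c₁ hw₁) (lam / toPlace w.1 w₁ δw)) * toPlace w.1 w₁ δw = lam - (galAdicCompletionMap (L := E') c₁ hw₁) lam := by
        rw [map_div₀, hρj]; field_simp
      rw [← h1, h0, zero_mul]
    rw [this, map_zero] at hjlv
    exact WithZero.zero_ne_coe hjlv
  have ha0 : a ≠ 0 := by
    intro h0
    apply h𝔩0
    have h1 : (((γH.1.val : GL (Fin 2) (UnitaryGroup.LocalRing L v)).val.map (Pi.evalRingHom (fun w' : UnitaryGroup.PlacesOver L v => w'.1.adicCompletion L) w))).trace / δw - 2 = 0 := by rw [← ha, h0, map_zero]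
    have h2 := h𝔩sq
    rw [h1, zero_mul, map_zero] at h2
    exact pow_eq_zero_iff (two_ne_zero) |>.1 h2
  -- `c` with `c² = a + 4` (deep: `|a∕4 + 1 − 1| < |4|` in `F_v`)
  have h2F : toPlace v w (2 : (v.adicCompletion ↥(maximalRealSubfield L))) = 2 := map_ofNat _ 2
  have h20F : (2 : (v.adicCompletion ↥(maximalRealSubfield L))) ≠ 0 := fun h0 => h20 (by rw [← h2F, h0, map_zero])
  have haF : Valued.v (toPlace v w a) ≤ Valued.v ϖ ^ (2 * d + 4 * tE + 2 + tE) := by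
    rw [ha, show (((γH.1.val : GL (Fin 2) (UnitaryGroup.LocalRing L v)).val.map (Pi.evalRingHom (fun w' : UnitaryGroup.PlacesOver L v => w'.1.adicCompletion L) w))).trace / δw - 2 = (((((γH.1.val : GL (Fin 2) (UnitaryGroup.LocalRing L v)).val.map (Pi.evalRingHom (fun w' : UnitaryGroup.PlacesOver L v => w'.1.adicCompletion L) w))).trace - 2) - 2 * (δw - 1)) / δw by field_simp; ring, map_div₀]
    have hδv : Valued.v δw = 1 := by
      have h := Valuation.map_add_eq_of_lt_left Valued.v (show Valued.v (δw - 1) < Valued.v (1 : w.1.adicCompletion L) by rwa [map_one])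
      rw [map_one, add_sub_cancel] at h; exact h
    rw [hδv, div_one]
    refine (Valuation.map_sub _ _ _).trans (max_le ?_ ?_)
    · rw [← map_pow]; exact F0P3cDyRamTypeTwoTubeLetters.v_trace_sub_two_le hg
    · rw [map_mul, h2t, show 2 * d + 4 * tE + 2 + tE = tE + (2 * d + 4 * tE + 2) by omega, pow_add]
      exact mul_le_mul_of_nonneg_left hδn zero_le
  have hs4 : Valued.v (a / 4 + 1 - 1) < Valued.v (4 : (v.adicCompletion ↥(maximalRealSubfield L))) := by
    rw [add_sub_cancel_right]
    have h4F : toPlace v w (4 : (v.adicCompletion ↥(maximalRealSubfield L))) = 4 := map_ofNat _ 4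
    have key : Valued.v (toPlace v w (a / 4)) < Valued.v (toPlace v w 4) := by
      have h4w : Valued.v (4 : w.1.adicCompletion L) = Valued.v ϖ ^ (tE + tE) := by
        rw [show (4 : w.1.adicCompletion L) = 2 * 2 by norm_num, map_mul, h2t, pow_add]
      have h4ne : Valued.v (4 : w.1.adicCompletion L) ≠ 0 := by rw [h4w]; exact pow_ne_zero _ (by rw [hϖ]; exact WithZero.exp_ne_zero)
      rw [map_div₀, h4F, map_div₀, div_lt_iff₀ (zero_lt_iff.2 h4ne), h4w, ← pow_add]
      refine haF.trans_lt ?_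
      exact F0P3cDyRamUniformizerPowerTube.v_pow_lt_v_pow hϖ (show tE + tE + (tE + tE) < 2 * d + 4 * tE + 2 + tE by omega)
    rw [hι2, hι2] at key
    exact lt_of_pow_lt_pow_left₀ 2 zero_le key
  obtain ⟨r₀, hr₀, -⟩ := Literature.NumberTheory.LocalFields.exists_mul_self_eq_of_valued_sub_one_lt_four_adicCompletion ↥(maximalRealSubfield L) v (a / 4 + 1) hs4
  have hcsq : (2 * r₀) * (2 * r₀) = a + 4 := by
    have : (2 * r₀) * (2 * r₀) = 4 * (r₀ * r₀) := by ring
    rw [this, hr₀]; field_simp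
  have hc0 : 2 * r₀ ≠ 0 := by
    intro h0
    have h1 : a + 4 = 0 := by rw [← hcsq, h0, zero_mul]
    have h2 : Valued.v (toPlace v w a) = Valued.v (toPlace v w (4 : (v.adicCompletion ↥(maximalRealSubfield L)))) := by
      rw [show a = -4 from eq_neg_of_add_eq_zero_left h1, map_neg, Valuation.map_neg]
    rw [map_ofNat, show (4 : w.1.adicCompletion L) = 2 * 2 by norm_num, map_mul, h2t, ← pow_add] at h2
    have h3 := haF
    rw [h2, ← map_pow, F0P3cDyRamUniformizerPowerTube.v_pow_eq_exp_neg hϖ, ← map_pow, F0P3cDyRamUniformizerPowerTube.v_pow_eq_exp_neg hϖ, WithZero.exp_le_exp] at h3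
    omega
  have hac : ((toPlace w.1 w₁).comp (toPlace v w)) (a * (2 * r₀) ^ 2) = (lam / toPlace w.1 w₁ δw - (galAdicCompletionMap (L := E') c₁ hw₁) (lam / toPlace w.1 w₁ δw)) ^ 2 := by
    rw [h𝔩sq, RingHom.comp_apply, sq, hcsq, map_mul, map_add, ha, map_ofNat]
  -- the model letters of ★ p857525: `hσres`, `hKev` (★ p858152), `hKnorm` (★ p858220 + ★ brick 9 §2)
  have hσres : ∀ z : w₁.1.adicCompletion E', (galAdicCompletionMap (L := E') c₁ hw₁) z = z → Valued.v z ≤ 1 → Valued.v (Θ z - z) < 1 := by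
    intro z hz hz1
    obtain ⟨az, rfl⟩ := (hjfix z).1 hz
    obtain ⟨y, -, hy⟩ := hresE az ((hjv az).1 hz1)
    rw [hΘj, ← map_sub, hjv1, show (galAdicCompletionMap (L := L) (IsCMField.complexConj L) hw) az - az = (galAdicCompletionMap (L := L) (IsCMField.complexConj L) hw) (az - toPlace v w y) - (az - toPlace v w y) by rw [map_sub, hσι]; ring]
    exact lt_of_le_of_lt (Valuation.map_sub _ _ _) (max_lt (by rw [hσv]; exact hy) hy)
  have hΘϖE : Θ (toPlace w.1 w₁ ϖ) ≠ toPlace w.1 w₁ ϖ := by rw [hΘj]; exact fun h => hσϖ ((toPlace w.1 w₁).injective h)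
  have hKev : ∀ A B : (v.adicCompletion ↥(maximalRealSubfield L)), ((toPlace w.1 w₁).comp (toPlace v w)) A + ((toPlace w.1 w₁).comp (toPlace v w)) B * (lam / toPlace w.1 w₁ δw - (galAdicCompletionMap (L := E') c₁ hw₁) (lam / toPlace w.1 w₁ δw)) ≠ 0 →
      Even (WithZero.log (Valued.v (((toPlace w.1 w₁).comp (toPlace v w)) A + ((toPlace w.1 w₁).comp (toPlace v w)) B * (lam / toPlace w.1 w₁ δw - (galAdicCompletionMap (L := E') c₁ hw₁) (lam / toPlace w.1 w₁ δw))))) := by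
    intro A B hAB
    have hfix : Θ ((galAdicCompletionMap (L := E') c₁ hw₁) (((toPlace w.1 w₁).comp (toPlace v w)) A + ((toPlace w.1 w₁).comp (toPlace v w)) B * (lam / toPlace w.1 w₁ δw - (galAdicCompletionMap (L := E') c₁ hw₁) (lam / toPlace w.1 w₁ δw)))) =
        ((toPlace w.1 w₁).comp (toPlace v w)) A + ((toPlace w.1 w₁).comp (toPlace v w)) B * (lam / toPlace w.1 w₁ δw - (galAdicCompletionMap (L := E') c₁ hw₁) (lam / toPlace w.1 w₁ δw)) := by
      rw [map_add, map_mul, map_add, map_mul, RingHom.comp_apply, RingHom.comp_apply, hρj, hρj, hΘj, hΘj, hσι, hσι, hΘρ𝔩]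
    obtain ⟨k, hk⟩ := F0P3cDyRamThetaRhoFixedEven.even_v_of_thetaRho_fixed hρρ hvρ hΘΘ hΘρ hvΘ hα1 hint hA hτα hσres hϖE (hρj ϖ) hΘϖE _ hfix hAB
    rw [hk, WithZero.log_exp]
    exact even_two_mul k
  have hKnorm : ∀ y : (v.adicCompletion ↥(maximalRealSubfield L)), Valued.v y = 1 → ∃ A B : (v.adicCompletion ↥(maximalRealSubfield L)), ((toPlace w.1 w₁).comp (toPlace v w)) y =
      (((toPlace w.1 w₁).comp (toPlace v w)) A + ((toPlace w.1 w₁).comp (toPlace v w)) B * (lam / toPlace w.1 w₁ δw - (galAdicCompletionMap (L := E') c₁ hw₁) (lam / toPlace w.1 w₁ δw))) *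
      (((toPlace w.1 w₁).comp (toPlace v w)) A - ((toPlace w.1 w₁).comp (toPlace v w)) B * (lam / toPlace w.1 w₁ δw - (galAdicCompletionMap (L := E') c₁ hw₁) (lam / toPlace w.1 w₁ δw))) := by
    intro y hy1
    have hz1 : Valued.v (((toPlace w.1 w₁).comp (toPlace v w)) y) = 1 := by rw [RingHom.comp_apply, hjv1, hι2, hy1, one_pow]
    obtain ⟨κ, hκ, -, hκn⟩ := F0P3cDyRamThetaRhoFixedNormUnit.exists_thetaRho_fixed_unit_norm_eq hρρ hvρ hΘΘ hΘρ hvΘ h2M hα1 hint hA hτα hσres hϖE (hρj ϖ) hΘϖE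
      _ (by rw [RingHom.comp_apply, hρj]) (by rw [RingHom.comp_apply, hΘj, hσι]) hz1
    obtain ⟨A₀, B₀, hσA, hσB, hκAB⟩ := F0P3cDyRamTypeASignModel.exists_coords_of_thetaRho_fixed (galAdicCompletionMap (L := L) (IsCMField.complexConj L) hw) (toPlace w.1 w₁) (galAdicCompletionMap (L := E') c₁ hw₁) Θ hρρ hΘΘ hjfix hΘj h2Mne h𝔩0 hρ𝔩 hΘ𝔩 hκ
    obtain ⟨A, hA'⟩ := exists_toPlace_eq_of_galAdicCompletionMap_eq (IsCMField.complexConj L) w (IsCMField.complexConj_ne_one L) hw _ hσA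
    obtain ⟨B, hB'⟩ := exists_toPlace_eq_of_galAdicCompletionMap_eq (IsCMField.complexConj L) w (IsCMField.complexConj_ne_one L) hw _ hσB
    refine ⟨A, B, ?_⟩
    simp only [RingHom.comp_apply] at hκn ⊢
    rw [hA', hB', ← F0P3cDyRamTypeASignModel.mul_map_of_coords (toPlace w.1 w₁) (galAdicCompletionMap (L := E') c₁ hw₁) hρj hρ𝔩 A₀ B₀, ← hκAB, hκn]
  haveI : NeZero (2 : (v.adicCompletion ↥(maximalRealSubfield L))) := ⟨h20F⟩
  have hAsym : ∀ y : (v.adicCompletion ↥(maximalRealSubfield L)), y ≠ 0 → (hilbertSymbol (v.adicCompletion ↥(maximalRealSubfield L)) y a = 1 ↔ Even (WithZero.log (Valued.v y))) := fun y hy =>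
    Literature.NumberTheory.QuadraticForms.hilbertSymbol_eq_one_iff_even_of_unramifiedModel ((toPlace w.1 w₁).comp (toPlace v w))
      (fun y => by rw [RingHom.comp_apply, hjv1, hι2]) hvρ (fun y => by rw [RingHom.comp_apply, hρj]) hρ𝔩 h2Mne hKev hKnorm hϖF hc0 hac hy
  -- ★ O-Sign
  exact F0P3cDyRamTokenSignUnr.hilbertSymbol_token_eq_neg_one_pow L w hw he ϖ d tE hD hσu hδδ hσδ hN.1 hN.2.1 hdeep hϖF hm hβ ha0 ha' hAsym

end Summit.HodgeConjecture.HodgeConjecture.Cruxes.H413.F0P3cDyRamOrderCountCensusUnrSign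

end
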